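import Literature.Algebra.Polynomial.CasasAlvero.Degree8Char419
import Literature.Algebra.Polynomial.CasasAlvero.Degree8Char443
import Literature.Algebra.Polynomial.CasasAlvero.Degree8Char499
import Literature.Algebra.Polynomial.CasasAlvero.Transfer
import Mathlib.Tactic.NormNum.Prime
import HarnessLib

/-!
# Casas-Alvero in the degrees `8·419^k`, `8·443^k`, `8·499^k` over every field of characteristic `0`

[GrafVonBothmerEtAl2007, Props. 2, 6] (as used in [CastryckLaterveerOunaies2012, §1–2]): if `p` is a good prime for the degree `a`
(no Casas-Alvero polynomial of degree `a` over `𝔽̄_p`), then the Casas-Alvero conjecture holds in characteristic `0` in every degree `a·p^k`.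
Here the hypothesis is a THEOREM of the tree for `a = 8` and `p ∈ {419, 443, 499}`: `CA_{8·p^k}` holds over EVERY field of characteristic `p`
(`Degree8Char419.lean`, `Degree8Char443.lean`, `Degree8Char499.lean` — `876` kernel-evaluated scenario certificates each, criterion
`Degree8ScenarioCriterion.lean`), and the GvBLSW transfer `holdsInDegree_of_charP_of_charZero` (`Transfer.lean`) moves it to characteristic `0`,
exactly as `Degree7CharZero.lean` does for `7·127^k`.  The degree `8 = 2³` itself was already covered (prime power); the smallest NEW
characteristic-`0` degrees are `3352 = 8·419`, `3544 = 8·443`, `3992 = 8·499` — none of the form `a·q^k` with `a ≤ 7` and `q` prime, so outside every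
previously landed characteristic-`0` family of this directory.  Literature status, stated precisely: [CastryckLaterveerOunaies2012, (4).8] reports that the
exhaustive bad-prime list is out of reach for `d = 8` and tabulates only the SMALLEST non-bad prime for `d ≤ 10` (table not held by this project:
acquisition request acq-09667); the tree proves independently that every prime `11 ≤ p ≤ 409` and `421, 431, 433, 439, 449, …` (all `p ≤ 499` other than
`419, 443, 499`) is bad for `8` (explicit examples, `Char<P>Digits*.lean`), so `419` is the smallest good prime of degree `8` coprime to `8`
(`ClassificationSummary499.holdsInDegree_eight_iff_of_prime_char_le_499`).  No `sorry`, no new axioms.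
-/

noncomputable section

open Polynomial

universe u

namespace Literature.Algebra.Polynomial.CasasAlvero

variable (K : Type u) [Field K] [CharZero K]

/-- **Degree `8·419^k` in characteristic `0`**: `419` is a good prime for degree `8` (a Lean theorem here:
`holdsInDegree_eight_mul_pow_of_char_419`), so `CA_{8·419^k}` holds over every field of characteristic `0`.
[cite: GrafVonBothmerEtAl2007, Prop. 6] [cite: CastryckLaterveerOunaies2012, Sec. 2] -/
theorem holdsInDegree_eight_mul_pow_419_of_charZero (k : ℕ) : HoldsInDegree K (8 * 419 ^ k) := by
  haveI : Fact (Nat.Prime 419) := ⟨by norm_num⟩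
  exact holdsInDegree_of_charP_of_charZero 419 (fun F _ _ => holdsInDegree_eight_mul_pow_of_char_419 (K := F) k) K

/-- **Degree `8·443^k` in characteristic `0`** (`443` is a good prime for degree `8`: `holdsInDegree_eight_mul_pow_of_char_443`).
[cite: GrafVonBothmerEtAl2007, Prop. 6] [cite: CastryckLaterveerOunaies2012, Sec. 2] -/
theorem holdsInDegree_eight_mul_pow_443_of_charZero (k : ℕ) : HoldsInDegree K (8 * 443 ^ k) := by
  haveI : Fact (Nat.Prime 443) := ⟨by norm_num⟩
  exact holdsInDegree_of_charP_of_charZero 443 (fun F _ _ => holdsInDegree_eight_mul_pow_of_char_443 (K := F) k) K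

/-- **Degree `8·499^k` in characteristic `0`** (`499` is a good prime for degree `8`: `holdsInDegree_eight_mul_pow_of_char_499`).
[cite: GrafVonBothmerEtAl2007, Prop. 6] [cite: CastryckLaterveerOunaies2012, Sec. 2] -/
theorem holdsInDegree_eight_mul_pow_499_of_charZero (k : ℕ) : HoldsInDegree K (8 * 499 ^ k) := by
  haveI : Fact (Nat.Prime 499) := ⟨by norm_num⟩
  exact holdsInDegree_of_charP_of_charZero 499 (fun F _ _ => holdsInDegree_eight_mul_pow_of_char_499 (K := F) k) K

/-- The smallest new characteristic-`0` degrees this gives: `3352 = 8·419`, `3544 = 8·443`, `3992 = 8·499`.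
[cite: GrafVonBothmerEtAl2007, Prop. 6] -/
theorem holdsInDegree_3352_3544_3992_of_charZero :
    HoldsInDegree K 3352 ∧ HoldsInDegree K 3544 ∧ HoldsInDegree K 3992 := by
  refine ⟨?_, ?_, ?_⟩
  · simpa using holdsInDegree_eight_mul_pow_419_of_charZero K 1
  · simpa using holdsInDegree_eight_mul_pow_443_of_charZero K 1
  · simpa using holdsInDegree_eight_mul_pow_499_of_charZero K 1

end Literature.Algebra.Polynomial.CasasAlvero
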